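import Literature.Analysis.Matrix.FiniteRangeDecompositionSymbol
import Literature.Analysis.Matrix.FiniteRangeDecompositionMomentum
import Mathlib.Data.Nat.Log
import Mathlib.Analysis.SpecificLimits.Basic
import HarnessLib

/-!
# Finite-range decomposition: the volume-uniform single-shell bound in three dimensions

The quantitative half of [cite: BrydgesGuadagniMitter2004, Thm. 1.1] / [cite: Bauerschmidt2013, (1.10)]
for the dyadic Fejér decomposition (`Literature/Analysis/Matrix/FiniteRangeDecomposition.lean`,
`…Symbol.lean`): on a three-dimensional discrete torus the `N`-th piece satisfies
`sup_{x,y} |C_N(x,y)| ≤ C(c₀) · 2^{−N}` UNIFORMLY IN THE VOLUME — the scaling `L^{−(d−2)j}` of a single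
momentum shell in `d = 3`.

Setting (abstract torus): a finite abelian group `G` with three elements `e₀,e₁,e₂` of orders dividing
`L₀,L₁,L₂` on which characters are determined (`hgen`) and `|G| ≥ L₀L₁L₂` (for
`G = (ℤ/L)² × ℤ/M`: the unit vectors), a translation-invariant symmetric `A` with
`c₀ · Σ_i (2 − 2 Re ψ(e_i)) ≤ σ_A(ψ)` (domination of the nearest-neighbour Laplacian symbol
`ε(ψ) = Σ_i 4 sin²(π t_i)`) and `A ≤ 4`.  Then for `2^N ≤ L_i`:

  `|G|⁻¹ Σ_ψ σ_{C_N}(ψ) ≤ (27/4 + π⁴/c₀²) · 2^{−N}`   (`avg_symbol_frdPiece_le`),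
  `|C_N(x,y)| ≤ (27/4 + π⁴/c₀²) · 2^{−N}`            (`abs_frdPiece_apply_le_inv_two_pow`).

Proof: each character has momenta `t_i ∈ (−1/2, 1/2]` with `ψ(e_i) = e^{2πi t_i}`, `t_i L_i ∈ ℤ`
(`addCharMomentum`); `2 − 2Re ψ(e_i) = 4 sin²(πt_i) ≥ 16 t_i²` (Jordan); the symbol bounds
`σ_{C_N} ≤ 4^{N−1}` and `σ_{C_N} σ_A² ≤ π⁴/4^{N+1}` are summed over the cube `|t|_∞ < 2^{−N}` and the
dyadic shells `2^{j−N} ≤ |t|_∞ < 2^{j+1−N}`, whose cardinalities are at most `Π_i (2L_iρ + 1)` by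
injectivity of `ψ ↦ (t_i L_i)_i` (`card_filter_momentum_lt_le`).  All [folklore].
-/

noncomputable section

open Finset Real
open Literature.Analysis.Fourier Literature.Analysis.Fourier.TrigApprox

namespace Literature.Analysis.Matrix

variable {G : Type*} [AddCommGroup G] [Fintype G] [DecidableEq G]

/-! ## The dyadic shell argument -/

section Shells

variable {A : _root_.Matrix G G ℝ}

omit [Fintype G] [DecidableEq G] [AddCommGroup G] in
/-- `4^N = (2^N)²`. [folklore] -/
private theorem four_pow_eq (N : ℕ) : (4 : ℝ) ^ N = (2 ^ N) ^ 2 := by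
  rw [show (4 : ℝ) = 2 ^ 2 by norm_num, ← pow_mul, mul_comm, pow_mul]

/-- **Pointwise domination** of the symbol by the cube/shell indicator sums. [folklore] -/
theorem symbol_frdPiece_re_le_shells
    (e : Fin 3 → G) (Ls : Fin 3 → ℕ) (hL : ∀ i, Ls i ≠ 0) (he : ∀ i, Ls i • e i = 0)
    (hA : IsTranslationInvariant A) (hs : A.IsHermitian) (h0 : A.PosSemidef)
    (h4 : ((4 : ℝ) • (1 : _root_.Matrix G G ℝ) - A).PosSemidef)
    {c₀ : ℝ} (hc₀ : 0 < c₀)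
    (hcoer : ∀ ψ : AddChar G ℂ, c₀ * ∑ i, (2 - 2 * (ψ (e i)).re) ≤ (symbol A ψ).re)
    (N : ℕ) (ψ : AddChar G ℂ) :
    (symbol (frdPiece A N) ψ).re
      ≤ (2 ^ N) ^ 2 / 4 * (if ∀ i, |addCharMomentum (Ls i) (e i) ψ| < 1 / 2 ^ N then (1 : ℝ) else 0)
        + ∑ j ∈ Finset.range N, π ^ 4 * (2 ^ N) ^ 2 / (1024 * c₀ ^ 2 * ((2 : ℝ) ^ j) ^ 4)
            * (if ∀ i, |addCharMomentum (Ls i) (e i) ψ| < 2 ^ (j + 1) / 2 ^ N then (1 : ℝ) else 0) := by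
  set T : ℝ := 2 ^ N with hT
  have hTpos : 0 < T := by positivity
  set t : Fin 3 → ℝ := fun i => addCharMomentum (Ls i) (e i) ψ with ht
  set s := (symbol (frdPiece A N) ψ).re with hsdef
  set a := (symbol A ψ).re with hadef
  have hs0 : 0 ≤ s := symbol_frdPiece_re_nonneg ψ hA hs h0 h4 N
  have hsX : s ≤ T ^ 2 / 4 := by
    have := symbol_frdPiece_re_le ψ hA hs h0 h4 N
    rwa [four_pow_eq] at this
  have hsY : s * a ^ 2 ≤ π ^ 4 / (4 * T ^ 2) := by
    have := symbol_frdPiece_re_mul_sq_le ψ hA hs h0 h4 N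
    have h4T : (4 : ℝ) ^ (N + 1) = 4 * T ^ 2 := by rw [pow_succ, four_pow_eq, hT]; ring
    rwa [h4T] at this
  -- nonnegativity of the shell terms
  have hB0 : ∀ j, 0 ≤ π ^ 4 * T ^ 2 / (1024 * c₀ ^ 2 * ((2 : ℝ) ^ j) ^ 4)
      * (if ∀ i, |t i| < 2 ^ (j + 1) / T then (1 : ℝ) else 0) := by
    intro j
    apply mul_nonneg (by positivity)
    split_ifs <;> norm_num
  have hsum0 : 0 ≤ ∑ j ∈ Finset.range N, π ^ 4 * T ^ 2 / (1024 * c₀ ^ 2 * ((2 : ℝ) ^ j) ^ 4)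
      * (if ∀ i, |t i| < 2 ^ (j + 1) / T then (1 : ℝ) else 0) :=
    Finset.sum_nonneg fun j _ => hB0 j
  by_cases hcube : ∀ i, |t i| < 1 / T
  · rw [if_pos hcube, mul_one]
    linarith
  -- outside the small cube: locate the dyadic shell of `u = max_i |t_i|`
  rw [if_neg hcube, mul_zero, zero_add]
  obtain ⟨i₁, hi₁⟩ : ∃ i, 1 / T ≤ |t i| := by
    by_contra hcon
    exact hcube fun i => lt_of_not_ge fun h => hcon ⟨i, h⟩
  obtain ⟨i₀, -, hi₀⟩ := Finset.exists_max_image Finset.univ (fun i => |t i|) Finset.univ_nonempty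
  set u := |t i₀| with hu
  have hi₀' : ∀ i, |t i| ≤ u := fun i => hi₀ i (Finset.mem_univ i)
  have hτu : 1 / T ≤ u := hi₁.trans (hi₀' i₁)
  have hu_half : u ≤ 1 / 2 := abs_addCharMomentum_le (hL i₀) (he i₀) ψ
  have hTu1 : 1 ≤ T * u := by rw [div_le_iff₀ hTpos] at hτu; linarith
  -- the integer part and its binary logarithm
  set n₀ := ⌊T * u⌋₊ with hn₀
  have hn₀1 : 1 ≤ n₀ := Nat.le_floor (by exact_mod_cast hTu1)
  have hn₀le : (n₀ : ℝ) ≤ T * u := Nat.floor_le (by positivity)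
  have hn₀lt : T * u < n₀ + 1 := Nat.lt_floor_add_one _
  set j := Nat.log 2 n₀ with hj
  have hj1 : 2 ^ j ≤ n₀ := Nat.pow_log_le_self 2 (by omega)
  have hj2 : n₀ < 2 ^ (j + 1) := Nat.lt_pow_succ_log_self (by norm_num) n₀
  have hj1r : (2 : ℝ) ^ j ≤ T * u := le_trans (by exact_mod_cast hj1) hn₀le
  have hj2r : T * u < (2 : ℝ) ^ (j + 1) := by
    have : ((n₀ : ℝ) + 1) ≤ (2 : ℝ) ^ (j + 1) := by exact_mod_cast hj2
    linarith
  -- `j < N`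
  have hjN : j < N := by
    have h1 : (2 : ℝ) ^ j < 2 ^ N := by
      calc (2 : ℝ) ^ j ≤ T * u := hj1r
        _ ≤ T * (1 / 2) := by gcongr
        _ < T := by linarith
        _ = 2 ^ N := hT
    exact (pow_lt_pow_iff_right₀ (by norm_num : (1 : ℝ) < 2)).mp h1
  -- the shell indicator is on
  have hind : (∀ i, |t i| < 2 ^ (j + 1) / T) := by
    intro i
    rw [lt_div_iff₀ hTpos]
    calc |t i| * T ≤ u * T := by gcongr; exact hi₀' i
      _ = T * u := by ring
      _ < 2 ^ (j + 1) := hj2r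
  -- the lower bound on `a`
  have ha : 16 * c₀ * (2 ^ j) ^ 2 / T ^ 2 ≤ a := by
    have h1 : 16 * u ^ 2 ≤ 2 - 2 * (ψ (e i₀)).re := by
      have := sixteen_mul_sq_le (hL i₀) (he i₀) ψ
      rw [hu, sq_abs]
      exact this
    have h2 : 2 - 2 * (ψ (e i₀)).re ≤ ∑ i, (2 - 2 * (ψ (e i)).re) :=
      Finset.single_le_sum (fun i _ => two_sub_two_re_nonneg (hL i) (he i) ψ) (Finset.mem_univ i₀)
    have h3 := hcoer ψ
    have hu2 : (2 ^ j) ^ 2 / T ^ 2 ≤ u ^ 2 := by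
      rw [div_le_iff₀ (by positivity)]
      calc ((2 : ℝ) ^ j) ^ 2 ≤ (T * u) ^ 2 := by gcongr
        _ = u ^ 2 * T ^ 2 := by ring
    calc 16 * c₀ * (2 ^ j) ^ 2 / T ^ 2 = c₀ * (16 * ((2 ^ j) ^ 2 / T ^ 2)) := by ring
      _ ≤ c₀ * (16 * u ^ 2) := by gcongr
      _ ≤ c₀ * (2 - 2 * (ψ (e i₀)).re) := by gcongr
      _ ≤ c₀ * ∑ i, (2 - 2 * (ψ (e i)).re) := by gcongr
      _ ≤ a := h3
  have hapos : 0 < a := lt_of_lt_of_le (by positivity) ha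
  -- `s ≤ B_j`
  have hsB : s ≤ π ^ 4 * T ^ 2 / (1024 * c₀ ^ 2 * ((2 : ℝ) ^ j) ^ 4) := by
    have h1 : s ≤ π ^ 4 / (4 * T ^ 2) / a ^ 2 := by
      rw [le_div_iff₀ (by positivity)]; exact hsY
    have h2 : π ^ 4 / (4 * T ^ 2) / a ^ 2
        ≤ π ^ 4 / (4 * T ^ 2) / (16 * c₀ * (2 ^ j) ^ 2 / T ^ 2) ^ 2 := by
      gcongr
    have h3 : π ^ 4 / (4 * T ^ 2) / (16 * c₀ * (2 ^ j) ^ 2 / T ^ 2) ^ 2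
        = π ^ 4 * T ^ 2 / (1024 * c₀ ^ 2 * ((2 : ℝ) ^ j) ^ 4) := by
      field_simp
      ring
    linarith
  -- the `j`-th term of the shell sum already dominates `s`
  have hmem : j ∈ Finset.range N := Finset.mem_range.mpr hjN
  calc s ≤ π ^ 4 * T ^ 2 / (1024 * c₀ ^ 2 * ((2 : ℝ) ^ j) ^ 4)
        * (if ∀ i, |t i| < 2 ^ (j + 1) / T then (1 : ℝ) else 0) := by
          rw [if_pos hind, mul_one]; exact hsB
    _ ≤ ∑ j ∈ Finset.range N, π ^ 4 * T ^ 2 / (1024 * c₀ ^ 2 * ((2 : ℝ) ^ j) ^ 4)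
        * (if ∀ i, |t i| < 2 ^ (j + 1) / T then (1 : ℝ) else 0) :=
      Finset.single_le_sum (fun j _ => hB0 j) hmem

omit [DecidableEq G] [AddCommGroup G] in
/-- `|G|⁻¹ Π_i (2 L_i ρ + 1) ≤ Π_i (2ρ + 1/L_i)` when `|G| ≥ Π_i L_i`. [folklore] -/
theorem inv_card_mul_prod_le {Ls : Fin 3 → ℕ} (hLr : ∀ i, (0 : ℝ) < Ls i)
    (hcard : ∏ i, (Ls i : ℝ) ≤ Fintype.card G) {ρ : ℝ} (hρ : 0 < ρ) :
    (Fintype.card G : ℝ)⁻¹ * ∏ i, (2 * (Ls i : ℝ) * ρ + 1) ≤ ∏ i, (2 * ρ + 1 / (Ls i : ℝ)) := by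
  have hprodpos : 0 < ∏ i, (Ls i : ℝ) := Finset.prod_pos fun i _ => hLr i
  have hcardpos : (0 : ℝ) < Fintype.card G := hprodpos.trans_le hcard
  have hkey : ∏ i, (2 * (Ls i : ℝ) * ρ + 1) = (∏ i, (Ls i : ℝ)) * ∏ i, (2 * ρ + 1 / (Ls i : ℝ)) := by
    rw [← Finset.prod_mul_distrib]
    refine Finset.prod_congr rfl fun i _ => ?_
    have := (hLr i).ne'
    field_simp
  rw [hkey, ← mul_assoc]
  have h1 : (Fintype.card G : ℝ)⁻¹ * ∏ i, (Ls i : ℝ) ≤ 1 := by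
    rw [inv_mul_le_iff₀ hcardpos, mul_one]; exact hcard
  exact mul_le_of_le_one_left (Finset.prod_nonneg fun i _ => by
    have := hLr i; positivity) h1

omit [DecidableEq G] [Fintype G] [AddCommGroup G] in
/-- `Π_i (2ρ + 1/L_i) ≤ (3ρ)³` when `1/L_i ≤ 1/T ≤ ρ`. [folklore] -/
theorem prod_two_mul_add_inv_le {Ls : Fin 3 → ℕ} {T ρ : ℝ} (hT : 0 < T) (hLT : ∀ i, T ≤ (Ls i : ℝ))
    (hρ : 1 / T ≤ ρ) : ∏ i, (2 * ρ + 1 / (Ls i : ℝ)) ≤ (3 * ρ) ^ 3 := by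
  have hρ0 : 0 < ρ := lt_of_lt_of_le (by positivity) hρ
  calc ∏ i, (2 * ρ + 1 / (Ls i : ℝ)) ≤ ∏ _i : Fin 3, (3 * ρ) := by
        refine Finset.prod_le_prod (fun i _ => ?_) fun i _ => ?_
        · have : (0 : ℝ) < Ls i := hT.trans_le (hLT i)
          positivity
        · have : 1 / (Ls i : ℝ) ≤ 1 / T := one_div_le_one_div_of_le hT (hLT i)
          linarith
    _ = (3 * ρ) ^ 3 := by rw [Finset.prod_const, Finset.card_univ, Fintype.card_fin]

/-- **The volume-uniform single-shell bound in `d = 3`.**  Under the hypotheses of the header: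
`|G|⁻¹ Σ_ψ σ_{C_N}(ψ) ≤ (27/4 + π⁴/c₀²)·2^{−N}` whenever `2^N ≤ L_i`.
[cite: BrydgesGuadagniMitter2004, Thm. 1.1 (the bound for `|α| = 0`, `d = 3`)] -/
theorem avg_symbol_frdPiece_le
    (e : Fin 3 → G) (Ls : Fin 3 → ℕ) (he : ∀ i, Ls i • e i = 0)
    (hgen : ∀ ψ φ : AddChar G ℂ, (∀ i, ψ (e i) = φ (e i)) → ψ = φ)
    (hcard : ∏ i, (Ls i : ℝ) ≤ Fintype.card G)
    (hA : IsTranslationInvariant A) (hs : A.IsHermitian) (h0 : A.PosSemidef)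
    (h4 : ((4 : ℝ) • (1 : _root_.Matrix G G ℝ) - A).PosSemidef)
    {c₀ : ℝ} (hc₀ : 0 < c₀)
    (hcoer : ∀ ψ : AddChar G ℂ, c₀ * ∑ i, (2 - 2 * (ψ (e i)).re) ≤ (symbol A ψ).re)
    (N : ℕ) (hLN : ∀ i, 2 ^ N ≤ Ls i) :
    (Fintype.card G : ℝ)⁻¹ * ∑ ψ : AddChar G ℂ, (symbol (frdPiece A N) ψ).re
      ≤ (27 / 4 + π ^ 4 / c₀ ^ 2) / 2 ^ N := by
  set T : ℝ := 2 ^ N with hT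
  have hTpos : 0 < T := by positivity
  have hL : ∀ i, Ls i ≠ 0 := fun i => by
    have := hLN i; have := Nat.one_le_two_pow (n := N); omega
  have hLr : ∀ i, (0 : ℝ) < Ls i := fun i => Nat.cast_pos.mpr (Nat.pos_of_ne_zero (hL i))
  have hLT : ∀ i, T ≤ Ls i := fun i => by rw [hT]; exact_mod_cast hLN i
  have hcardpos : (0 : ℝ) < Fintype.card G := Nat.cast_pos.mpr Fintype.card_pos
  -- abbreviations for the counts
  set c0 : ℝ := ((Finset.univ.filter fun ψ : AddChar G ℂ =>
      ∀ i, |addCharMomentum (Ls i) (e i) ψ| < 1 / T).card : ℝ) with hc0def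
  set cj : ℕ → ℝ := fun j => ((Finset.univ.filter fun ψ : AddChar G ℂ =>
      ∀ i, |addCharMomentum (Ls i) (e i) ψ| < 2 ^ (j + 1) / T).card : ℝ) with hcjdef
  set B : ℕ → ℝ := fun j => π ^ 4 * T ^ 2 / (1024 * c₀ ^ 2 * ((2 : ℝ) ^ j) ^ 4) with hBdef
  have hB0 : ∀ j, 0 ≤ B j := fun j => by rw [hBdef]; positivity
  -- Step 1: pointwise domination, summed over `ψ`
  have hpt := fun ψ => symbol_frdPiece_re_le_shells e Ls hL he hA hs h0 h4 hc₀ hcoer N ψ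
  have hsum : ∑ ψ : AddChar G ℂ, (symbol (frdPiece A N) ψ).re
      ≤ T ^ 2 / 4 * c0 + ∑ j ∈ Finset.range N, B j * cj j := by
    refine (Finset.sum_le_sum fun ψ _ => hpt ψ).trans (le_of_eq ?_)
    rw [Finset.sum_add_distrib, ← Finset.mul_sum, Finset.sum_boole, Finset.sum_comm]
    congr 1
    refine Finset.sum_congr rfl fun j _ => ?_
    rw [← Finset.mul_sum, Finset.sum_boole]
  -- Step 2: counts, divided by the volume
  have hc0 : (Fintype.card G : ℝ)⁻¹ * c0 ≤ (3 * (1 / T)) ^ 3 := by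
    have h1 := card_filter_momentum_lt_le e Ls hL he hgen (show (0 : ℝ) < 1 / T by positivity)
    calc (Fintype.card G : ℝ)⁻¹ * c0
        ≤ (Fintype.card G : ℝ)⁻¹ * ∏ i, (2 * (Ls i : ℝ) * (1 / T) + 1) := by gcongr
      _ ≤ ∏ i, (2 * (1 / T) + 1 / (Ls i : ℝ)) := inv_card_mul_prod_le hLr hcard (by positivity)
      _ ≤ (3 * (1 / T)) ^ 3 := prod_two_mul_add_inv_le hTpos hLT le_rfl
  have hcj : ∀ j, (Fintype.card G : ℝ)⁻¹ * cj j ≤ (3 * (2 ^ (j + 1) / T)) ^ 3 := by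
    intro j
    have h1 := card_filter_momentum_lt_le e Ls hL he hgen (show (0 : ℝ) < 2 ^ (j + 1) / T by positivity)
    calc (Fintype.card G : ℝ)⁻¹ * cj j
        ≤ (Fintype.card G : ℝ)⁻¹ * ∏ i, (2 * (Ls i : ℝ) * (2 ^ (j + 1) / T) + 1) := by gcongr
      _ ≤ ∏ i, (2 * (2 ^ (j + 1) / T) + 1 / (Ls i : ℝ)) := inv_card_mul_prod_le hLr hcard (by positivity)
      _ ≤ (3 * (2 ^ (j + 1) / T)) ^ 3 := by
          refine prod_two_mul_add_inv_le hTpos hLT ?_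
          gcongr
          exact one_le_pow₀ (by norm_num)
  -- Step 3: the arithmetic of each term
  have hterm0 : T ^ 2 / 4 * ((Fintype.card G : ℝ)⁻¹ * c0) ≤ 27 / 4 / T := by
    calc T ^ 2 / 4 * ((Fintype.card G : ℝ)⁻¹ * c0) ≤ T ^ 2 / 4 * (3 * (1 / T)) ^ 3 := by gcongr
      _ = 27 / 4 / T := by field_simp; ring
  have htermj : ∀ j, B j * ((Fintype.card G : ℝ)⁻¹ * cj j) ≤ 27 * π ^ 4 / (128 * c₀ ^ 2 * T) * (1 / 2) ^ j := by
    intro j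
    calc B j * ((Fintype.card G : ℝ)⁻¹ * cj j) ≤ B j * (3 * (2 ^ (j + 1) / T)) ^ 3 :=
          mul_le_mul_of_nonneg_left (hcj j) (hB0 j)
      _ = 27 * π ^ 4 / (128 * c₀ ^ 2 * T) * (1 / 2) ^ j := by
          rw [hBdef]
          set S : ℝ := 2 ^ j with hS
          have hS0 : (0 : ℝ) < S := by positivity
          simp only []
          rw [show (2 : ℝ) ^ (j + 1) = 2 * S by rw [pow_succ, hS]; ring,
            show (1 / 2 : ℝ) ^ j = 1 / S by rw [one_div_pow, hS]]
          field_simp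
          ring
  -- Step 4: assemble
  calc (Fintype.card G : ℝ)⁻¹ * ∑ ψ : AddChar G ℂ, (symbol (frdPiece A N) ψ).re
      ≤ (Fintype.card G : ℝ)⁻¹ * (T ^ 2 / 4 * c0 + ∑ j ∈ Finset.range N, B j * cj j) := by gcongr
    _ = T ^ 2 / 4 * ((Fintype.card G : ℝ)⁻¹ * c0)
        + ∑ j ∈ Finset.range N, B j * ((Fintype.card G : ℝ)⁻¹ * cj j) := by
          rw [mul_add, Finset.mul_sum]
          congr 1
          · ring
          · exact Finset.sum_congr rfl fun j _ => by ring
    _ ≤ 27 / 4 / T + ∑ j ∈ Finset.range N, 27 * π ^ 4 / (128 * c₀ ^ 2 * T) * (1 / 2) ^ j :=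
          add_le_add hterm0 (Finset.sum_le_sum fun j _ => htermj j)
    _ = 27 / 4 / T + 27 * π ^ 4 / (128 * c₀ ^ 2 * T) * ∑ j ∈ Finset.range N, (1 / 2 : ℝ) ^ j := by
          rw [Finset.mul_sum]
    _ ≤ 27 / 4 / T + 27 * π ^ 4 / (128 * c₀ ^ 2 * T) * 2 := by
          gcongr
          exact sum_geometric_two_le N
    _ ≤ (27 / 4 + π ^ 4 / c₀ ^ 2) / T := by
          have hpi : 0 ≤ π ^ 4 / (c₀ ^ 2 * T) := by positivity
          have : 27 / 4 / T + 27 * π ^ 4 / (128 * c₀ ^ 2 * T) * 2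
              = (27 / 4 + π ^ 4 / c₀ ^ 2) / T - (37 / 64) * (π ^ 4 / (c₀ ^ 2 * T)) := by
            field_simp
            ring
          rw [this]
          linarith

/-- **Volume-uniform kernel bound in `d = 3`**: `|C_N(x,y)| ≤ (27/4 + π⁴/c₀²)·2^{−N}` for `2^N ≤ L_i`.
[cite: Bauerschmidt2013, (1.10) (the case `|α| = 0`, `d = 3`)] -/
theorem abs_frdPiece_apply_le_inv_two_pow
    (e : Fin 3 → G) (Ls : Fin 3 → ℕ) (he : ∀ i, Ls i • e i = 0)
    (hgen : ∀ ψ φ : AddChar G ℂ, (∀ i, ψ (e i) = φ (e i)) → ψ = φ)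
    (hcard : ∏ i, (Ls i : ℝ) ≤ Fintype.card G)
    (hA : IsTranslationInvariant A) (hs : A.IsHermitian) (h0 : A.PosSemidef)
    (h4 : ((4 : ℝ) • (1 : _root_.Matrix G G ℝ) - A).PosSemidef)
    {c₀ : ℝ} (hc₀ : 0 < c₀)
    (hcoer : ∀ ψ : AddChar G ℂ, c₀ * ∑ i, (2 - 2 * (ψ (e i)).re) ≤ (symbol A ψ).re)
    (N : ℕ) (hLN : ∀ i, 2 ^ N ≤ Ls i) (x y : G) :
    |frdPiece A N x y| ≤ (27 / 4 + π ^ 4 / c₀ ^ 2) / 2 ^ N :=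
  (abs_frdPiece_apply_le hA hs N x y).trans
    (avg_symbol_frdPiece_le e Ls he hgen hcard hA hs h0 h4 hc₀ hcoer N hLN)

end Shells

end Literature.Analysis.Matrix

end
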